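import Literature.NumberTheory.EllipticCurves.GrossZagierRankOne
import Literature.NumberTheory.EllipticCurves.GrossZagierRationalPoint
import Literature.NumberTheory.EllipticCurves.HeegnerPointsModularityProofs
import Literature.NumberTheory.EllipticCurves.RootNumberEvenAnalyticRankProofs
import Literature.NumberTheory.EllipticCurves.BSDQuadraticDescent
import Literature.NumberTheory.EllipticCurves.BSDInvariantsLeadingCoeffProofs
import HarnessLib

/-!
# The rank-one Gross–Zagier fact over `ℚ` from the primary theorems of the tree

Proofs-only companion (theorems only: no definition, no named fact, nothing restated; D-0026) of
`Literature.NumberTheory.EllipticCurves.GrossZagierRankOne`, whose named fact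
`WeierstrassCurve.gross_zagier_rank_one_rat` reads: for an elliptic curve `E/ℚ` with
`ord_{s=1} L(E, s) = 1` there are `P ∈ E(ℚ)` and a REAL `c > 0` with `L'(E, 1) = c · ĥ(P)`
(`leadingLCoeff = L'(E, 1)` at analytic rank one). Since `ĥ ≥ 0` vanishes exactly on torsion
(Silverman, *AEC*, Thm. VIII.9.3 (d), proved in `HeightsProofs`), the fact says precisely:
**`L'(E, 1) > 0` and `E(ℚ)` has a point of infinite order.** Both are consequences of theorems
that the tree already states as primary named facts, along the printed descent of Gross–Zagier
1986, V.§2 (pp. 312–313, proof of Thm. I.(7.3)) and of Darmon 2004, §3.9 (proof of Thm. 3.22):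

1. `ord_{s=1} L(E, s) = 1` is odd, so `w(E) = -1` (parity `WeierstrassCurve.even_analyticRank_iff`,
   a theorem given modularity: `RootNumberEvenAnalyticRankProofs`); Waldspurger's theorem
   (`waldspurger_exists_heegnerField_twist_ne_zero`, Waldspurger 1985 Thm. 5 — GZ86 V.§2, p. 312:
   "we choose a `K` by Waldspurger's theorem so that `L_ε(f, 1) ≠ 0`") gives an imaginary
   quadratic `K` satisfying the Heegner hypothesis for `N_E` with `L(E^{(d_K)}, 1) ≠ 0`.
2. The Heegner point `P_K ∈ E(K)` (`exists_isHeegnerPoint`, Gross 1984) and the Gross–Zagier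
   formula (`gross_zagier`, GZ86 Thm. V.(2.1), p. 311:
   `L'(E/K, 1) = ‖ω‖² ĥ(P_K)/(c² u² |D|^{1/2})`) make `L'(E/K, 1)` a NON-NEGATIVE REAL number
   (`ĥ ≥ 0` on `E(K)`, `canonicalHeight_nonneg_holds`).
3. `L(E/K, s) = L(E, s) L(E^{(d_K)}, s)` (GZ86 V.§1, p. 308: "`L'(f, 1) L_ε(f, 1) = L'(f, 1, 1)`";
   in the tree `LDerivEK` IS the derivative of the product), and `L(E, 1) = 0`, so
   `L'(E/K, 1) = L'(E, 1) · L(E^{(d_K)}, 1)` (product rule).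
4. `L(E^{(d_K)}, 1)` is real (`iteratedDeriv_entireLFunction_ofReal_im`, integer Dirichlet
   coefficients) and `≥ 0` (`WeierstrassCurve.re_entireLFunction_one_nonneg`: Guo 1996 /
   Lapid–Rallis 2003, Thm. 1), hence `> 0`; `L'(E, 1)` is real (`leadingLCoeff_im`) and `≠ 0`
   (simple zero), hence **`L'(E, 1) > 0`**.
5. `L'(E/K, 1) ≠ 0`, so `P_K` has infinite order (Gross–Zagier;
   `not_isOfFinAddOrder_of_isHeegnerPoint_of_LDerivEK_ne_zero`), and by Darmon's Prop. 3.11 —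
   PROVED in the tree, `heegnerPoint_conj_add_rootNumber_smul_holds` — `σ P_K − P_K` is torsion
   for the reflection `σ` of `K` since `w(E) = -1`; hence `P = P_K + σ P_K ∈ E(ℚ)` (GZ86 V.§2,
   p. 313: "If we take `P = P_K + P̄_K ∈ E(ℚ)` …") has infinite order
   (`exists_not_isOfFinAddOrder_of_conjMap_sub_isOfFinAddOrder`, the point-valued form of
   `one_le_mordellWeilRank_of_conjMap_sub_isOfFinAddOrder` of `LeadingTermHeegnerProofs`).
6. `ĥ(P) > 0` (VIII.9.3 (d)); put `c = L'(E, 1)/ĥ(P) > 0`. A non-minimal model is handled through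
   a global minimal model (`hasGlobalMinimalModel_rat_holds`) and the invariance of `r_an`,
   `leadingLCoeff` and the point group under changes of variables
   (`analyticRank_variableChange_holds`, `leadingLCoeff_variableChange_holds`,
   `VariableChange.pointEquiv`).

Deviation from print (shorter road): Gross–Zagier descend Thm. V.(2.1) with the period identity
`‖ω‖²/|D|^{1/2} = Ω Ω'/[E(ℝ):E(ℝ)⁰]` and modular symbols for `L(E', 1) = β' Ω'` to get the
RATIONALITY `α ∈ ℚ^×` of Thm. I.(7.3) (that statement is the separate fact
`GrossZagier1986_thm_I_7_3`); `gross_zagier_rank_one_rat` asserts only a real `c > 0`, for which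
steps 3–6 suffice and no comparison `ĥ_K = 2 ĥ_ℚ` of heights is needed.

Main results:

* `leadingLCoeff_re_pos_of_analyticRank_eq_one_of_heegnerPoint` — `L'(E, 1) > 0` at analytic
  rank one, from parity, Waldspurger, Gross–Zagier, the Heegner point and `L(·, 1) ≥ 0`;
* `gross_zagier_rank_one_rat_of_heegnerPoint` — the fact from parity (`hpar`), the entire
  continuation (`hE`), Waldspurger (`hWa`), Gross–Zagier over `K` (`hGZ`), Heegner points over `K`
  (`hHP`), Prop. 3.11 (`hτ`) and `L(·, 1) ≥ 0` (`hL0`);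
* `gross_zagier_rank_one_rat_of_modularity` — the same with `hpar`, `hE`, `hτ` supplied from
  modularity in Version `L` (`existsUnique_isNewformOf`) by theorems of the tree;
* `gross_zagier_rank_one_rat_of_nonempty_modularParametrizationData` — the same from modularity
  in the parametrisation form `nonempty_modularParametrizationData` (BCDT 2001, Thm. A with (6)),
  which also supplies `hHP` (`exists_isHeegnerPoint_of_nonempty_modularParametrizationData`):
  **`gross_zagier_rank_one_rat` follows from `nonempty_modularParametrizationData`,
  `waldspurger_exists_heegnerField_twist_ne_zero`, `gross_zagier` and
  `re_entireLFunction_one_nonneg`** — four primary named facts, each a single printed theorem.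

Nothing is discharged unconditionally; no statement of the tree is changed.

## References

* [GrossZagier1986] B. H. Gross, D. B. Zagier, *Heegner points and derivatives of `L`-series*,
  Invent. Math. 84 (1986), 225–320: Thm. V.(2.1) (p. 311), V.§1 (p. 308, the factorisation and
  Waldspurger's choice of `K`), V.§2 (pp. 312–313, proof of Thm. I.(7.3)); held as corpus
  `paper:url-d19484107fe2` (PDF pp. 106, 109, 112–113).
* [Darmon2004] H. Darmon, *Rational Points on Modular Elliptic Curves*, CBMS 101, AMS (2004),
  Prop. 3.11 and §3.9 (proof of Thm. 3.22). doi:10.1090/cbms/101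
* [LapidRallis2003] E. Lapid, S. Rallis, *On the nonnegativity of `L(1/2, π)` for `SO_{2n+1}`*,
  Ann. of Math. 157 (2003), Thm. 1 (`n = 1`: `PGL₂`); J. Guo, *On the positivity of the central
  critical values of automorphic `L`-functions for `GL(2)`*, Duke Math. J. 83 (1996).
* [SilvermanAEC2009] J. H. Silverman, *The Arithmetic of Elliptic Curves*, 2nd ed., GTM 106
  (2009), Thm. VIII.9.3 (d), Prop. III.3.1 (b), VIII.8.3.
-/

noncomputable section

open scoped Classical

open WeierstrassCurve WeierstrassCurve.QuadraticDescent

universe u v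

namespace Literature.NumberTheory.EllipticCurves

/-! ### Descent of a point fixed up to torsion by the reflection of a quadratic field -/

section Descent

variable {F : Type u} {K : Type v} [Field F] [Field K] [Algebra F K] [NeZero (2 : F)]

/-- **Descent, sign `−1`, point-valued** (Gross–Zagier 1986, V.§2, p. 313: "If we take
`P = P_K + P̄_K ∈ E(ℚ)` …"; Darmon 2004, §3.9: "`P_K` belongs to `E(ℚ)` up to torsion" when
`sign(E, ℚ) = -1`). For a quadratic extension `K/F` (`2 ≠ 0`), a non-trivial `F`-endomorphism `σ`
of `K` and `P ∈ W(K)` of infinite order with `σ P − P` of finite order, the point `P + σ P` is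
`σ`-fixed, hence comes from `W(F)`, and has infinite order (it is `2P + (σ P − P)`): so `W(F)` has a
point of infinite order. The point-valued form of
`one_le_mordellWeilRank_of_conjMap_sub_isOfFinAddOrder` (`LeadingTermHeegnerProofs`), same proof.
[cite: GrossZagier1986, V.§2 (p. 313)] -/
theorem exists_not_isOfFinAddOrder_of_conjMap_sub_isOfFinAddOrder (h2 : Module.finrank F K = 2)
    (W : WeierstrassCurve F) {σ : K →ₐ[F] K} (hσ : σ ≠ AlgHom.id F K)
    {P : (W.baseChange K).toAffine.Point} (hP : ¬ IsOfFinAddOrder P)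
    (hT : IsOfFinAddOrder (conjMap W σ P - P)) : ∃ R : W.toAffine.Point, ¬ IsOfFinAddOrder R := by
  have hσσ : ∀ z, σ (σ z) = z :=
    Literature.NumberTheory.EllipticCurves.Quadratic.apply_apply_of_ne_id h2 hσ
  set Q := P + conjMap W σ P with hQ
  have hQfix : conjMap W σ Q = Q := by
    rw [hQ, map_add, conjMap_conjMap W hσσ, add_comm]
  have hQnt : ¬ IsOfFinAddOrder Q := by
    intro hQt
    apply hP
    have h2P : IsOfFinAddOrder ((2 : ℤ) • P) := by
      have e : (2 : ℤ) • P = Q + -(conjMap W σ P - P) := by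
        rw [hQ, two_zsmul]
        abel
      rw [e]
      exact hQt.add hT.neg
    exact Literature.NumberTheory.EllipticCurves.isOfFinAddOrder_of_zsmul two_ne_zero h2P
  obtain ⟨R, hR⟩ := exists_incl_eq_of_conjMap_eq h2 W hσ hQfix
  exact ⟨R, fun h ↦ hQnt (hR ▸ (incl K W).isOfFinAddOrder h)⟩

end Descent

/-! ### `L'(E/K, 1)`: a non-negative real (Gross–Zagier) equal to `L'(E, 1) · L(E^{(d_K)}, 1)` -/

section OverK

variable {N : ℕ} [NeZero N] {W : WeierstrassCurve ℚ} {K : Type} [Field K] [NumberField K]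

/-- **Gross–Zagier ⇒ `L'(E/K, 1)` is a non-negative real number** (GZ86 Thm. V.(2.1), p. 311:
`L'(E/K, 1) = ‖ω‖² ĥ(P_K)/(c² u² |D|^{1/2})`, every factor non-negative — `covol(Λ_E) > 0`,
squares, a square root, and `ĥ ≥ 0` on `E(K)`, Silverman VIII.9.3). If the Gross–Zagier formula
holds for `(W, K)` at level `N` (`GrossZagierFormula`) and `P ∈ E(K)` is a Heegner point of level
`N`, then `Im L'(E/K, 1) = 0` and `0 ≤ Re L'(E/K, 1)`. [cite: GrossZagier1986, Thm. V.(2.1) (p. 311)] -/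
theorem lDerivEK_im_eq_zero_and_re_nonneg_of_isHeegnerPoint [W.IsElliptic]
    (hGZ : GrossZagierFormula N W K) {P : (W.baseChange K).toAffine.Point}
    (hP : IsHeegnerPoint N W K P) : (LDerivEK W K).im = 0 ∧ 0 ≤ (LDerivEK W K).re := by
  obtain ⟨Dt, H, ι, hι⟩ := hP
  have e := hGZ Dt H ι P hι
  haveI : (W.baseChange K).IsElliptic := by rw [baseChange]; infer_instance
  have hh : 0 ≤ Affine.Point.canonicalHeight P := Affine.Point.canonicalHeight_nonneg_holds P
  have hcov : 0 < ZLattice.covolume Dt.L.lattice := ZLattice.covolume_pos _ _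
  have hx : 0 ≤ 2 * ZLattice.covolume Dt.L.lattice /
      ((Dt.c : ℝ) ^ 2 * ((NumberField.Units.torsionOrder K : ℝ) / 2) ^ 2 * √|(NumberField.discr K : ℝ)|) *
        Affine.Point.canonicalHeight P := by
    positivity
  rw [e]
  exact ⟨Complex.ofReal_im _, by rwa [Complex.ofReal_re]⟩

/-- **`L'(E/K, 1) = L'(E, 1) · L(E^{(d_K)}, 1)` when `L(E, 1) = 0`** (GZ86 V.§1, p. 308:
"`L'(f, 1) L_ε(f, 1) = L'(f, 1, 1)`"; `L(E/K, s) = L(E, s) L(E^{(d_K)}, s)` is the definition of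
`LDerivEK`): the product rule, both factors being entire (`hasEntireLFunction_rat`, hypothesis
`hE`). [cite: GrossZagier1986, V.§1 (p. 308)] -/
theorem lDerivEK_eq_deriv_mul_of_entireLFunction_one_eq_zero (hE : hasEntireLFunction_rat)
    (W : WeierstrassCurve ℚ) [W.IsElliptic] (K : Type) [Field K] [NumberField K]
    (h0 : W.entireLFunction 1 = 0) :
    LDerivEK W K = deriv W.entireLFunction 1 *
      (W.quadraticTwist (NumberField.discr K : ℚ)).entireLFunction 1 := by
  have hd : (NumberField.discr K : ℚ) ≠ 0 := by exact_mod_cast NumberField.discr_ne_zero K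
  haveI := W.isElliptic_quadraticTwist hd
  have hdW : DifferentiableAt ℂ W.entireLFunction 1 := (W.differentiable_entireLFunction (hE W)) 1
  have hdW' : DifferentiableAt ℂ (W.quadraticTwist (NumberField.discr K : ℚ)).entireLFunction 1 :=
    ((W.quadraticTwist (NumberField.discr K : ℚ)).differentiable_entireLFunction (hE _)) 1
  unfold LDerivEK
  rw [deriv_fun_mul hdW hdW', h0, zero_mul, add_zero]

end OverK

/-! ### `L'(E, 1) > 0` and a rational point of infinite order, for a globally minimal model -/

section Minimal

/-- **Gross–Zagier 1986, V.§2 for a globally minimal model: `L'(E, 1) > 0` and a point of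
infinite order in `E(ℚ)`**, along the printed proof (module docstring, steps 1–6). Inputs: the
parity of the analytic rank (`hpar`, `WeierstrassCurve.even_analyticRank_iff`), the entire
continuation (`hE`, `hasEntireLFunction_rat`), Waldspurger's twist (`hWa`), the Gross–Zagier
formula over `K` (`hGZ`, `gross_zagier`), the `K`-rationality of the Heegner point (`hHP`,
`exists_isHeegnerPoint`), Darmon's Prop. 3.11 (`hτ`, `heegnerPoint_conj_add_rootNumber_smul`)
and the non-negativity of central values (`hL0`, `re_entireLFunction_one_nonneg`).
[cite: GrossZagier1986, V.§2 (pp. 312–313)] -/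
theorem leadingLCoeff_re_pos_and_exists_not_isOfFinAddOrder_of_isGloballyMinimal
    (hpar : ∀ W : WeierstrassCurve ℚ, W.even_analyticRank_iff) (hE : hasEntireLFunction_rat)
    (hWa : waldspurger_exists_heegnerField_twist_ne_zero)
    (hGZ : ∀ (N : ℕ) [NeZero N] (W : WeierstrassCurve ℚ) (K : Type) [Field K] [NumberField K],
      gross_zagier N W K)
    (hHP : ∀ (W : WeierstrassCurve ℚ) (K : Type) [Field K] [NumberField K],
      exists_isHeegnerPoint W K)
    (hτ : heegnerPoint_conj_add_rootNumber_smul) (hL0 : re_entireLFunction_one_nonneg)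
    (W : WeierstrassCurve ℚ) [W.IsElliptic] [W.IsGloballyMinimal] (h1 : W.analyticRank = 1) :
    0 < (W.leadingLCoeff).re ∧ ∃ P : W.toAffine.Point, ¬ IsOfFinAddOrder P := by
  haveI : NeZero (W.conductorNorm ℤ) := ⟨(W.conductorNorm_pos_holds).ne'⟩
  -- (1) `w(E) = -1` by parity; the Heegner field of Waldspurger
  have hw : W.rootNumber = -1 := by
    rcases W.rootNumber_eq_one_or with hw | hw
    · exact absurd ((hpar W).mpr hw) (by rw [h1]; exact Nat.not_even_one)
    · exact hw
  obtain ⟨K, _, _, hKq, hH, hLt⟩ := hWa.exists W hw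
  have hd : (NumberField.discr K : ℚ) ≠ 0 := by exact_mod_cast NumberField.discr_ne_zero K
  haveI := W.isElliptic_quadraticTwist hd
  -- (2) the Heegner point and Gross–Zagier: `L'(E/K, 1)` is a non-negative real
  obtain ⟨P, hP⟩ := hHP W K hKq hH
  have hGZ' : GrossZagierFormula (W.conductorNorm ℤ) W K := hGZ _ W K hKq hH
  obtain ⟨himK, hreK⟩ := lDerivEK_im_eq_zero_and_re_nonneg_of_isHeegnerPoint hGZ' hP
  -- (3) product rule
  have h0 : W.entireLFunction 1 = 0 := entireLFunction_one_eq_zero_of_analyticRank_eq_one h1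
  obtain ⟨hlead, hder⟩ := leadingLCoeff_eq_deriv_of_analyticRank_eq_one h1
  have hprod : LDerivEK W K =
      W.leadingLCoeff * (W.quadraticTwist (NumberField.discr K : ℚ)).entireLFunction 1 := by
    rw [hlead]
    exact lDerivEK_eq_deriv_mul_of_entireLFunction_one_eq_zero hE W K h0
  -- (4) reality and signs
  have hne : W.leadingLCoeff ≠ 0 := by rw [hlead]; exact hder
  have himW : (W.leadingLCoeff).im = 0 := W.leadingLCoeff_im
  have himW' : ((W.quadraticTwist (NumberField.discr K : ℚ)).entireLFunction 1).im = 0 := by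
    simpa using (W.quadraticTwist (NumberField.discr K : ℚ)).iteratedDeriv_entireLFunction_ofReal_im 0 1
  have hreW' : 0 < ((W.quadraticTwist (NumberField.discr K : ℚ)).entireLFunction 1).re := by
    rcases (hL0 (W.quadraticTwist (NumberField.discr K : ℚ))).lt_or_eq with h | h
    · exact h
    · exact absurd (Complex.ext (by simpa using h.symm) (by simpa using himW')) hLt
  have hre : (LDerivEK W K).re =
      (W.leadingLCoeff).re * ((W.quadraticTwist (NumberField.discr K : ℚ)).entireLFunction 1).re := by
    rw [hprod, Complex.mul_re, himW, himW', mul_zero, sub_zero]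
  have hre0 : 0 ≤ (W.leadingLCoeff).re := by
    by_contra hneg
    have : (W.leadingLCoeff).re *
        ((W.quadraticTwist (NumberField.discr K : ℚ)).entireLFunction 1).re < 0 :=
      mul_neg_of_neg_of_pos (not_le.mp hneg) hreW'
    linarith
  have hre1 : (W.leadingLCoeff).re ≠ 0 := fun h ↦
    hne (Complex.ext (by simpa using h) (by simpa using himW))
  refine ⟨lt_of_le_of_ne hre0 (Ne.symm hre1), ?_⟩
  -- (5) `P_K` has infinite order; reflection, Prop. 3.11, descent
  have hL : LDerivEK W K ≠ 0 := by
    rw [hprod]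
    exact mul_ne_zero hne hLt
  have hPnt : ¬ IsOfFinAddOrder P :=
    not_isOfFinAddOrder_of_isHeegnerPoint_of_LDerivEK_ne_zero hGZ' hP hL
  obtain ⟨θ, c, hθ, hc⟩ :=
    Literature.NumberTheory.QuadraticFields.Quadratic.exists_sq_eq_algebraMap (F := ℚ) (K := K) hKq.1
  have hσ : Literature.NumberTheory.QuadraticFields.Quadratic.conj hKq.1 hθ hc ≠ AlgHom.id ℚ K := by
    intro hid
    have h1' : Literature.NumberTheory.QuadraticFields.Quadratic.conj hKq.1 hθ hc θ = -θ :=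
      Literature.NumberTheory.QuadraticFields.Quadratic.conj_gen hKq.1 hθ hc
    rw [hid, AlgHom.id_apply] at h1'
    have h2θ : (2 : K) * θ = 0 := by linear_combination h1'
    exact Literature.NumberTheory.QuadraticFields.Quadratic.ne_zero_of_not_mem_range hθ
      ((mul_eq_zero.mp h2θ).resolve_left two_ne_zero)
  have hT := hτ W K hKq hH hP _ hσ
  rw [hw, neg_one_zsmul, ← sub_eq_add_neg] at hT
  obtain ⟨R, hR⟩ := exists_not_isOfFinAddOrder_of_conjMap_sub_isOfFinAddOrder hKq.1 W hσ hPnt hT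
  -- (the point group of `W/ℚ` carries the computable `DecidableEq ℚ` here and the classical one in
  -- the lemma over a general base field; they agree by subsingleton elimination)
  exact ⟨R, fun h ↦ hR (by convert h)⟩

end Minimal

/-! ### Any model: `L'(E, 1) > 0`, a point of infinite order, and the fact -/

section Assembly

/-- **`L'(E, 1) > 0` and a rational point of infinite order at analytic rank one, any model**:
`leadingLCoeff_re_pos_and_exists_not_isOfFinAddOrder_of_isGloballyMinimal` on a global minimal
model `C • W` (`hasGlobalMinimalModel_rat_holds`, Silverman VIII.8.3), transported back by the
invariance of the analytic rank and of the leading coefficient under changes of variables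
(`analyticRank_variableChange_holds`, `leadingLCoeff_variableChange_holds`) and the isomorphism
of point groups `W(ℚ) ≃+ (C • W)(ℚ)` (`VariableChange.pointEquiv`, Silverman III.3.1 (b)).
[cite: GrossZagier1986, V.§2 (pp. 312–313)] -/
theorem leadingLCoeff_re_pos_and_exists_not_isOfFinAddOrder_of_heegnerPoint
    (hpar : ∀ W : WeierstrassCurve ℚ, W.even_analyticRank_iff) (hE : hasEntireLFunction_rat)
    (hWa : waldspurger_exists_heegnerField_twist_ne_zero)
    (hGZ : ∀ (N : ℕ) [NeZero N] (W : WeierstrassCurve ℚ) (K : Type) [Field K] [NumberField K],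
      gross_zagier N W K)
    (hHP : ∀ (W : WeierstrassCurve ℚ) (K : Type) [Field K] [NumberField K],
      exists_isHeegnerPoint W K)
    (hτ : heegnerPoint_conj_add_rootNumber_smul) (hL0 : re_entireLFunction_one_nonneg)
    (W : WeierstrassCurve ℚ) [W.IsElliptic] (h1 : W.analyticRank = 1) :
    0 < (W.leadingLCoeff).re ∧ ∃ P : W.toAffine.Point, ¬ IsOfFinAddOrder P := by
  obtain ⟨C, hC⟩ := hasGlobalMinimalModel_rat_holds W
  haveI := hC
  have hanC : (C • W).analyticRank = W.analyticRank := analyticRank_variableChange_holds W C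
  have hleadC : (C • W).leadingLCoeff = W.leadingLCoeff := leadingLCoeff_variableChange_holds W C
  have h1' : (C • W).analyticRank = 1 := by rw [hanC, h1]
  obtain ⟨hre, P', hP'⟩ :=
    leadingLCoeff_re_pos_and_exists_not_isOfFinAddOrder_of_isGloballyMinimal hpar hE hWa hGZ hHP
      hτ hL0 (C • W) h1'
  refine ⟨by rwa [hleadC] at hre, (VariableChange.pointEquiv W C).symm P', fun hfin ↦ hP' ?_⟩
  have := (VariableChange.pointEquiv W C).toAddMonoidHom.isOfFinAddOrder hfin
  rwa [AddEquiv.coe_toAddMonoidHom, AddEquiv.apply_symm_apply] at this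

/-- **`L'(E, 1) > 0` at analytic rank one** (Gross–Zagier 1986, V.§2 with Thm. V.(2.1);
Waldspurger 1985; Guo 1996 / Lapid–Rallis 2003): the real number `L'(E, 1) = leadingLCoeff`
(`leadingLCoeff_im`) is positive for every elliptic `E/ℚ` with `ord_{s=1} L(E, s) = 1`, from
parity, the entire continuation, Waldspurger, Gross–Zagier over `K`, the Heegner point and
`L(·, 1) ≥ 0`; Prop. 3.11 is not needed for the sign but rides along in the shared lemma, and is
anyway a theorem of the tree (`heegnerPoint_conj_add_rootNumber_smul_holds`).
[cite: GrossZagier1986, V.§2 (pp. 312–313) with Thm. V.(2.1)] -/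
theorem leadingLCoeff_re_pos_of_analyticRank_eq_one_of_heegnerPoint
    (hpar : ∀ W : WeierstrassCurve ℚ, W.even_analyticRank_iff) (hE : hasEntireLFunction_rat)
    (hWa : waldspurger_exists_heegnerField_twist_ne_zero)
    (hGZ : ∀ (N : ℕ) [NeZero N] (W : WeierstrassCurve ℚ) (K : Type) [Field K] [NumberField K],
      gross_zagier N W K)
    (hHP : ∀ (W : WeierstrassCurve ℚ) (K : Type) [Field K] [NumberField K],
      exists_isHeegnerPoint W K)
    (hL0 : re_entireLFunction_one_nonneg)
    (W : WeierstrassCurve ℚ) [W.IsElliptic] (h1 : W.analyticRank = 1) :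
    0 < (W.leadingLCoeff).re :=
  (leadingLCoeff_re_pos_and_exists_not_isOfFinAddOrder_of_heegnerPoint hpar hE hWa hGZ hHP
    heegnerPoint_conj_add_rootNumber_smul_holds hL0 W h1).1

/-- **The rank-one Gross–Zagier fact over `ℚ` from the primary theorems** (Gross–Zagier 1986,
Thm. I.(7.3) positivity clause, proof V.§2 pp. 312–313; Darmon 2004 §3.9):
`WeierstrassCurve.gross_zagier_rank_one_rat` — `ord_{s=1} L(E, s) = 1 ⇒ L'(E, 1) = c · ĥ(P)` with
`P ∈ E(ℚ)`, `c > 0` real — follows from the parity of the analytic rank (`hpar`), the entire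
continuation (`hE`), Waldspurger's non-vanishing twist (`hWa`), the Gross–Zagier formula over `K`
(`hGZ`), the `K`-rationality of Heegner points (`hHP`), Darmon's Prop. 3.11 (`hτ`) and the
non-negativity of central `L`-values (`hL0`): take the point `P` of infinite order of
`leadingLCoeff_re_pos_and_exists_not_isOfFinAddOrder_of_heegnerPoint`, so `ĥ(P) > 0`
(Silverman VIII.9.3 (d), `canonicalHeight_eq_zero_iff_holds`, `canonicalHeight_nonneg_holds`),
and `c = L'(E, 1)/ĥ(P)`. [cite: GrossZagier1986, Thm. I.(7.3) and V.§2 (pp. 312–313)] -/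
theorem gross_zagier_rank_one_rat_of_heegnerPoint
    (hpar : ∀ W : WeierstrassCurve ℚ, W.even_analyticRank_iff) (hE : hasEntireLFunction_rat)
    (hWa : waldspurger_exists_heegnerField_twist_ne_zero)
    (hGZ : ∀ (N : ℕ) [NeZero N] (W : WeierstrassCurve ℚ) (K : Type) [Field K] [NumberField K],
      gross_zagier N W K)
    (hHP : ∀ (W : WeierstrassCurve ℚ) (K : Type) [Field K] [NumberField K],
      exists_isHeegnerPoint W K)
    (hτ : heegnerPoint_conj_add_rootNumber_smul) (hL0 : re_entireLFunction_one_nonneg) :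
    gross_zagier_rank_one_rat := by
  intro W _ h1
  obtain ⟨hre, P, hP⟩ :=
    leadingLCoeff_re_pos_and_exists_not_isOfFinAddOrder_of_heegnerPoint hpar hE hWa hGZ hHP hτ hL0
      W h1
  -- `ĥ(P) > 0`: non-negative, and zero only on torsion (the point group elaborated against the
  -- classical decidability instance of `Heights.lean`, as in `LeadingTermProofs`)
  have hh0 : Affine.Point.canonicalHeight P ≠ 0 := fun h0 ↦
    hP (by convert (Affine.Point.canonicalHeight_eq_zero_iff_holds (W := W) P).mp h0)
  have hhpos : 0 < Affine.Point.canonicalHeight P :=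
    lt_of_le_of_ne (Affine.Point.canonicalHeight_nonneg_holds P) (Ne.symm hh0)
  refine ⟨P, (W.leadingLCoeff).re / Affine.Point.canonicalHeight P, div_pos hre hhpos, ?_⟩
  rw [div_mul_cancel₀ _ hh0]
  exact Complex.ext (by simp) (by simpa using W.leadingLCoeff_im)

/-- **The rank-one Gross–Zagier fact over `ℚ` from modularity, Waldspurger, Gross–Zagier, Heegner
points over `K` and `L(·, 1) ≥ 0`**: as `gross_zagier_rank_one_rat_of_heegnerPoint`, with the
parity of the analytic rank and the entire continuation supplied from modularity in Version `L`
(`existsUnique_isNewformOf`, Breuil–Conrad–Diamond–Taylor 2001, Thm. A) by the tree's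
`even_analyticRank_iff_of_exists_isNewformOf` (Hecke's functional equation and Atkin–Lehner's
theorem, proved) and `hasEntireLFunction_rat_of_modularity`, and Prop. 3.11 by its discharge
`heegnerPoint_conj_add_rootNumber_smul_holds`. [cite: GrossZagier1986, Thm. I.(7.3) and V.§2 (pp. 312–313)] -/
theorem gross_zagier_rank_one_rat_of_modularity (hmod : ModularForms.existsUnique_isNewformOf)
    (hWa : waldspurger_exists_heegnerField_twist_ne_zero)
    (hGZ : ∀ (N : ℕ) [NeZero N] (W : WeierstrassCurve ℚ) (K : Type) [Field K] [NumberField K],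
      gross_zagier N W K)
    (hHP : ∀ (W : WeierstrassCurve ℚ) (K : Type) [Field K] [NumberField K],
      exists_isHeegnerPoint W K)
    (hL0 : re_entireLFunction_one_nonneg) : gross_zagier_rank_one_rat :=
  gross_zagier_rank_one_rat_of_heegnerPoint
    (even_analyticRank_iff_of_exists_isNewformOf (ModularForms.existsUnique_isNewformOf_iff.mp hmod))
    (hasEntireLFunction_rat_of_modularity hmod) hWa hGZ hHP
    heegnerPoint_conj_add_rootNumber_smul_holds hL0

/-- **The rank-one Gross–Zagier fact over `ℚ` from FOUR primary named facts**: modularity in the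
parametrisation form (`nonempty_modularParametrizationData`, Breuil–Conrad–Diamond–Taylor 2001,
Thm. A with (6) of p. 845 — it supplies a newform for every `E/ℚ`,
`exists_isNewformOf_of_nonempty_modularParametrizationData`, and the Heegner point over `K`,
`exists_isHeegnerPoint_of_nonempty_modularParametrizationData`), Waldspurger 1985 Thm. 5
(`waldspurger_exists_heegnerField_twist_ne_zero`), Gross–Zagier 1986 Thm. V.(2.1) in the form of
Cai–Shu–Tian 2014 Thm. 1.1 (`gross_zagier`) and Guo 1996 / Lapid–Rallis 2003 Thm. 1
(`re_entireLFunction_one_nonneg`). This is the currency of the rung W-ALL kernel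
(`Summits/BirchSwinnertonDyer/Rank1Residual/WAll/`), where it retires the composite sign binder
`hGZ : gross_zagier_rank_one_rat` of the leading-term reading.
[cite: GrossZagier1986, Thm. I.(7.3) and V.§2 (pp. 312–313)] [cite: BCDTJAMS2001, Theorem A] -/
theorem gross_zagier_rank_one_rat_of_nonempty_modularParametrizationData
    (hmodP : ModularForms.nonempty_modularParametrizationData)
    (hWa : waldspurger_exists_heegnerField_twist_ne_zero)
    (hGZ : ∀ (N : ℕ) [NeZero N] (W : WeierstrassCurve ℚ) (K : Type) [Field K] [NumberField K],
      gross_zagier N W K)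
    (hL0 : re_entireLFunction_one_nonneg) : gross_zagier_rank_one_rat :=
  have hnf : ModularForms.exists_isNewformOf :=
    ModularForms.exists_isNewformOf_of_nonempty_modularParametrizationData hmodP
  gross_zagier_rank_one_rat_of_heegnerPoint
    (even_analyticRank_iff_of_exists_isNewformOf hnf)
    (hasEntireLFunction_rat_of_exists_isNewformOf hnf) hWa hGZ
    (fun W K _ _ ↦ exists_isHeegnerPoint_of_nonempty_modularParametrizationData W K hmodP)
    heegnerPoint_conj_add_rootNumber_smul_holds hL0

end Assembly

end Literature.NumberTheory.EllipticCurves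

end
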